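import Mathlib
import HarnessLib
import Literature.Probability.Divergences.FiniteDataProcessing
import Literature.Probability.MarkovChains.TotalVariation
import Literature.Probability.MarkovChains.LogSobolevConstant

/-!
# Bridge: the finite `f`-divergence `fDivFin` specialises to `relEnt`, `tvDist` and the `χ²`-sum

[cite: PolyanskiyWu2024, §7.1 (Def. 7.1 with eqs. (7.3)–(7.4): `TV` and `χ²` as `f`-divergences; KL is
`f(x) = x log x`)]

`Probability/Divergences/FiniteDataProcessing.lean` proves data processing (PW Thm 7.4) and joint
convexity (Thm 7.5 (b)) for the general finite `f`-divergence `fDivFin f μ ν = Σ_x ν(x) f(μ(x)/ν(x))`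
and the channel output `channelLaw K μ`.  The Markov-chain / entropy files speak `relEnt`
(`MarkovChains/LogSobolevConstant.lean`), `tvDist` and `stepLaw` (`MarkovChains/TotalVariation.lean`).
This file records the identities that make the general theorems available in that vocabulary
(PROVED, 0 named facts, no definition):

* `fDivFin_mul_log_eq_relEnt` — `D_{x log x}(μ‖ν) = relEnt μ ν` for ALL real vectors (both sides use
  the conventions `x/0 = 0`, `log 0 = 0`);
* `fDivFin_abs_sub_one_eq_tvDist` — `D_{½|x−1|}(μ‖ν) = tvDist μ ν` when `ν(x) = 0 ⇒ μ(x) = 0`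
  ("`TV(P,Q) = ½ E_Q|dP/dQ − 1|`" [cite: PolyanskiyWu2024, §7.1 eq. (7.3)]);
* `fDivFin_sq_sub_one_eq` — `D_{(x−1)²}(μ‖ν) = Σ_x (μ(x) − ν(x))²/ν(x)` for `ν > 0`
  [cite: PolyanskiyWu2024, §7.1 eq. (7.4)] (the `chiSqSum` of `Entropy/KLChiSquareBound.lean`);
* `channelLaw_eq_stepLaw` — for a square channel `channelLaw K μ = stepLaw K μ` (`rfl`).

Consequently `Divergences.PolyanskiyWu2024_thm_7_4` / `_thm_7_5_b` with `f = x log x`, `f = ½|x − 1|`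
are the KL / TV data-processing and convexity statements that `Entropy/DivergenceDataProcessing.lean`
proves directly (`PolyanskiyWu2024_thm_2_17`, `PolyanskiyWu2024_thm_7_4_tv`, …) — one source of truth,
two vocabularies; new instance files are unnecessary.
-/

namespace Literature.Probability.Divergences

open Finset Real
open Literature.Probability.MarkovChains

variable {X : Type*} [Fintype X]

/-- KL is the `f`-divergence of `f(x) = x log x`: `fDivFin (x ↦ x log x) μ ν = relEnt μ ν`, with no
hypothesis (the conventions `x/0 = 0`, `log 0 = 0` agree on both sides).
[cite: PolyanskiyWu2024, §7.1 Def. 7.1 (KL divergence as `D_f`, `f = x log x`)] -/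
theorem fDivFin_mul_log_eq_relEnt (μ ν : X → ℝ) :
    fDivFin (fun t => t * Real.log t) μ ν = relEnt μ ν := by
  unfold fDivFin relEnt
  refine sum_congr rfl fun x _ => ?_
  beta_reduce
  by_cases hν : ν x = 0
  · rw [hν, zero_mul, div_zero, Real.log_zero, mul_zero]
  · rw [← mul_assoc, mul_div_cancel₀ _ hν]

/-- Total variation is the `f`-divergence of `f(x) = ½|x − 1|` whenever `μ ≪ ν`
(`ν(x) = 0 ⇒ μ(x) = 0`): `fDivFin (x ↦ |x − 1|/2) μ ν = tvDist μ ν`.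
[cite: PolyanskiyWu2024, §7.1 eq. (7.3)] -/
theorem fDivFin_abs_sub_one_eq_tvDist {μ ν : X → ℝ} (hν : ∀ x, 0 ≤ ν x)
    (hac : ∀ x, ν x = 0 → μ x = 0) :
    fDivFin (fun t => |t - 1| / 2) μ ν = tvDist μ ν := by
  unfold fDivFin tvDist
  rw [mul_sum]
  refine sum_congr rfl fun x _ => ?_
  beta_reduce
  by_cases h0 : ν x = 0
  · rw [h0, hac x h0, zero_mul, sub_zero, abs_zero, mul_zero]
  · have hpos : 0 < ν x := lt_of_le_of_ne (hν x) (Ne.symm h0)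
    rw [show μ x / ν x - 1 = (μ x - ν x) / ν x by field_simp, abs_div, abs_of_pos hpos]
    field_simp

/-- `χ²` is the `f`-divergence of `f(x) = (x − 1)²`: for `ν > 0`,
`fDivFin (x ↦ (x − 1)²) μ ν = Σ_x (μ(x) − ν(x))²/ν(x)`. [cite: PolyanskiyWu2024, §7.1 eq. (7.4)] -/
theorem fDivFin_sq_sub_one_eq {μ ν : X → ℝ} (hν : ∀ x, ν x ≠ 0) :
    fDivFin (fun t => (t - 1) ^ 2) μ ν = ∑ x, (μ x - ν x) ^ 2 / ν x := by
  unfold fDivFin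
  refine sum_congr rfl fun x _ => ?_
  beta_reduce
  rw [show μ x / ν x - 1 = (μ x - ν x) / ν x by field_simp [hν x]]
  field_simp [hν x]

/-- A square channel's output law is the tree's one-step law: `channelLaw K μ = stepLaw K μ`.
[cite: PolyanskiyWu2024, §7.2 Thm 7.4 (`P_Y = P_{Y|X} ∘ P_X`)] -/
theorem channelLaw_eq_stepLaw (K : X → X → ℝ) (μ : X → ℝ) : channelLaw K μ = stepLaw K μ := rfl

end Literature.Probability.Divergences
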